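import Summits.BirchSwinnertonDyer.Rank1Residual.Additive.LocalTorsionExponent
import Summits.BirchSwinnertonDyer.Rank1Residual.Additive.PotSupersingularClasses
import Summits.BirchSwinnertonDyer.Rank1Residual.Additive.KodairaDictionaryThree
import Summits.BirchSwinnertonDyer.Rank1Residual.Additive.LocalThreeTorsionIffTamagawaThreeOfIVHolds
import Literature.NumberTheory.EllipticCurves.LocalTorsionAdditiveReductionPPrimaryProofs
import Literature.NumberTheory.EllipticCurves.PastenValuationProductThm115Proofs
import Literature.NumberTheory.EllipticCurves.TamagawaNeZeroProofs
import Literature.NumberTheory.EllipticCurves.MazurTorsionOrderValuationProofs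
import Literature.NumberTheory.EllipticCurves.NeronTamagawa
import Literature.NumberTheory.EllipticCurves.NeronComponentDataProofs
import HarnessLib

/-!
# Route `KatoDescentPotSupersingular` (rung K9, cell `bsd-potss`), crux `WildUpperReducibleDefect` (item
# stmt-BirchSwinnertonDyer-19190), registered stub `stub_red_nineTorsionMember`: the `ℤ/9`-member disjunct READ AT
# ONE CURVE — rational torsion at an additive prime, UNCONDITIONALLY. ROUTE-FREE (imports no `Theses.*` file);
# a `--supports 19190 --as helper` file (seat `bsd-potss-k9-red9` g5); nothing booked, BSD is not proved by any of this

THE POINT. The stub's rows are the analytic-rank-`0` wild-`3` (class O6) rows with `E[3]` reducible whose `ℚ`-isogeny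
class contains a curve `W'` with `3² ∣ #W'(ℚ)_tors`. Class-wide the stub is Kato's sharp member count (held input
19707; by-name roads p459279) and its three census classes (54b, 1890r, 122094bl) are kernel records (p464900 …
p475729). This file supplies what the tree can say about such a `W'` WITHOUT any named fact — the local arithmetic of
rational torsion at an ADDITIVE prime (Silverman *AEC* VII.3.1 / VII.6.1: `E(ℚ_p)_tors ↪ E(ℚ_p)/E₁(ℚ_p)`, a group of
order `c_p · #Ẽ_ns(𝔽_p) = c_p · p`, `c_p ≤ 4`), in the currency `Addv W p` / `W.torsionOrder` /
`(W.baseChange ℚ_[p]).localTamagawaNumber ℤ_[p]` of the b2b cell, reusing its tools BY NAME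
(`LocalLog.card_torsion_dvd_of_hasAdditiveReduction`, `X11b.LocalTorsion.eq_zero_of_isInReductionKernel_of_prime_nsmul`,
Literature `index_formalFiltration_one_of_additive`, `localTamagawaNumber_padic_le_four`, the Kodaira dictionary at `3`):

* §1 **`#E(ℚ)_tors ∣ c_p · p` at an additive `p ≥ 3`** (`torsionOrder_dvd_localTamagawaNumber_mul_of_addv`), so
  `#E(ℚ)_tors ≤ 4p`. (The K8-t′ lane's `torsionOrder_dvd_natCard_torsion_padic`, p436151, lives in a route-importing
  module; the global-to-local step is re-derived privately here to keep this file route-free.)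
* §2 **`p = 3`**: at an additive `3`, `#E(ℚ)_tors ∣ 3·c₃ ≤ 12`, hence **`ord₃ #E(ℚ)_tors ≤ 2` WITHOUT Mazur's theorem**
  (`padicValNat_three_torsionOrder_le_two_of_addv_three`: the crux's «`3² ∣ #tors`» disjunct is the top — no `ℤ/27` row),
  and **`9 ∣ #E(ℚ)_tors ⟹ c₃ = 3`** (`localTamagawaNumber_eq_three_of_nine_dvd_torsionOrder_of_addv_three`).
* §3 **prime-to-`ℓ` torsion at an additive `ℓ`** (any prime `ℓ`, also `2`): a rational point of order `q^k`, `q ≠ ℓ`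
  prime, gives an element of order `q^k` in `E(ℚ_ℓ)/E₁(ℚ_ℓ)` (`E₁(ℚ_ℓ)[q] = 0`), so **`q^k ∣ c_ℓ ≤ 4`**
  (`pow_dvd_localTamagawaNumber_of_addOrderOf_eq_of_addv`); in particular **a curve with a rational point of order `9`
  is NOT additive at any `ℓ ≠ 3`** (`not_addv_of_addOrderOf_eq_nine`) — it is semistable away from `3`.
* §4 **`9 ∣ #E(ℚ)_tors ⟹ a rational point of order `9`** (`exists_addOrderOf_eq_nine_of_dvd_torsionOrder`), Mazur-free,
  from the shape `E(ℚ)_tors ≅ ℤ/k` or `ℤ/2k × ℤ/2` (tree `exists_torsionOrder_eq_addOrderOf_or`, Weil pairing).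
* §5 **the Kodaira type at `3`**: additive at `3` with `9 ∣ #E(ℚ)_tors` ⟹ `c₃ = 3 ∣ #Φ₃(𝔽̄₃)` ⟹ type `IV` or `IV*`
  (`kodairaSymbolAt_three_eq_IV_or_IVstar_of_nine_dvd_torsionOrder`), hence the WILD cell: `SubW W 3`, `ClassO6 W 3`,
  never (t′) (`classO6_three_of_nine_dvd_torsionOrder`, `not_subTprime_three_of_nine_dvd_torsionOrder`) — a `ℤ/9` curve
  additive at `3` is automatically an O6 row.

IN PRINT (context, not used): Barrios–Roy 2022 compute the local data of the Kubert family `E_{C₉}(a,b)`: additive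
reduction iff `p = 3` and `3 ∣ a + b`, and then Kodaira type `IV`, `f₃ = 3`, `c₃ = 3` (their Thm. 3.8 with its table,
arXiv:2104.10337 Case 3) — sharper than §5 (`IV`, not `IV*`, and the conductor exponent), by Tate's algorithm on the
explicit model; Lorenzini 2011 Prop. 1.1 (d): a rational point of order `9` forces `9 ∣ ∏ c_ℓ` (`81 ∣ ∏ c_ℓ` except for
54b3). The census (o6-r1 C-X3K-0: classes 54b, 1890r, 122094bl, `N = 27·2, 27·70, 27·4522`) matches §2–§5.

WHAT THIS IS NOT: not a bound on `Ш`; the stub is not advanced class-wide (it remains Kato's count-fact road); nothing is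
booked; no item is closed. The class-level statements (the stub's scope read on the `ℚ`-isogeny class, and the stub
reduced to its `ℤ/9` curves) are in the sibling file `…WildUpperReducibleNineTorsionStructure.lean`.

References: [SilvermanAEC2009] VII.2.1, VII.3.1 (with IV.3.2(b), IV.6.1), VII.6.1, Ex. 3.5; [SilvermanATAEC1994]
Cor. IV.9.2(c),(d), Table 4.1; [CremonaAlgorithms1997] §3.3; [BarriosRoy2022LocalData] Thm. 3.8 (table, `T = C₉`);
[Lorenzini2011TorsionTamagawa] Prop. 1.1 (d).
-/

set_option autoImplicit false
-- the Theorems directory repeats the summit name (sibling precedent `KatoDescentPotSupersingularAssembly.lean`)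
set_option linter.dupNamespace false

noncomputable section

open scoped Classical

namespace Summit.BirchSwinnertonDyer.BirchSwinnertonDyer.Theorems.WildUpperReducibleNineTorsionLocal

open WeierstrassCurve IsDedekindDomain Literature.NumberTheory.EllipticCurves
  Literature.NumberTheory.DiophantineGeometry
  Literature.NumberTheory.EllipticCurves.Rank1Residual
  Summit.BirchSwinnertonDyer.Rank1Residual
  Summit.BirchSwinnertonDyer.Rank1Residual.Additive

/-! ## §1 Rational torsion at an additive prime `p ≥ 3`: `#E(ℚ)_tors ∣ c_p · p` -/

section GlobalToLocal

variable (W : WeierstrassCurve ℚ) [W.IsElliptic] (p : ℕ) [hp : Fact p.Prime]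

omit [W.IsElliptic] in
/-- `#E(ℚ)_tors ∣ #E(ℚ_p)_tors`: Mathlib's `Affine.Point.map` along `ℚ → ℚ_p` restricts to an injective homomorphism of
torsion subgroups (Lagrange). Private route-free copy of the K8-t′ lane's `torsionOrder_dvd_natCard_torsion_padic`
(p436151, a route-importing module). [cite: SilvermanAEC2009, VII.3 Prop. 3.1] -/
private theorem torsionOrder_dvd_natCard_torsion_padic' :
    W.torsionOrder ∣ Nat.card (AddCommGroup.torsion (W.baseChange ℚ_[p]).toAffine.Point) := by
  set ι : W.toAffine.Point →+ (W.baseChange ℚ_[p]).toAffine.Point :=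
    WeierstrassCurve.Affine.Point.map (W' := W.toAffine) (S := ℚ) (Algebra.ofId ℚ ℚ_[p]) with hι
  have hinj : Function.Injective ι :=
    WeierstrassCurve.Affine.Point.map_injective (W' := W.toAffine) (f := Algebra.ofId ℚ ℚ_[p])
  set f : AddCommGroup.torsion W.toAffine.Point →+
      AddCommGroup.torsion (W.baseChange ℚ_[p]).toAffine.Point :=
    (ι.comp (AddCommGroup.torsion W.toAffine.Point).subtype).codRestrict _ (fun x ↦ by
      rw [AddCommGroup.mem_torsion]
      exact ι.isOfFinAddOrder ((AddCommGroup.mem_torsion _).mp x.2)) with hf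
  have hfinj : Function.Injective f := by
    intro x y hxy
    apply Subtype.ext
    apply hinj
    simpa [hf] using congrArg Subtype.val hxy
  rw [torsionOrder_eq_natCard_torsion]
  exact AddSubgroup.card_dvd_of_injective f hfinj

/-- **`0 < c_p ≤ 4` at an additive prime** (Kodaira–Néron, Silverman *ATAEC* Cor. IV.9.2(d): the tree's
`localTamagawaNumber_padic_le_four` off the split multiplicative case, `localTamagawaNumber_padic_ne_zero_holds`).
[cite: SilvermanATAEC1994, Cor. IV.9.2(d) (PDF p. 340)] -/
theorem localTamagawaNumber_padic_pos_le_four_of_addv (hadd : Addv W p) :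
    0 < (W.baseChange ℚ_[p]).localTamagawaNumber ℤ_[p] ∧
      (W.baseChange ℚ_[p]).localTamagawaNumber ℤ_[p] ≤ 4 := by
  haveI : (W.baseChange ℚ_[p]).IsElliptic := by rw [baseChange]; infer_instance
  exact ⟨Nat.pos_of_ne_zero (localTamagawaNumber_padic_ne_zero_holds p (W.baseChange ℚ_[p])),
    localTamagawaNumber_padic_le_four_of_not_mult W p hadd.2⟩

variable [W.IsGloballyMinimal]

/-- **`#E(ℚ)_tors ∣ c_p · p` at an additive prime `p ≥ 3`** (`W/ℚ` globally minimal): `E(ℚ)_tors ↪ E(ℚ_p)_tors ↪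
E(ℚ_p)/E₁(ℚ_p)` (`E₁(ℚ_p)` is torsion-free for `p ≥ 3`), a group of order `c_p · #Ẽ_ns(𝔽_p) = c_p · p` — the b2b cell's
`LocalLog.card_torsion_dvd_of_hasAdditiveReduction` composed with the global-to-local injection.
[cite: SilvermanAEC2009, VII.2 Prop. 2.1, VII.3 Prop. 3.1, Thm. VII.6.1 and Exercise 3.5] -/
theorem torsionOrder_dvd_localTamagawaNumber_mul_of_addv (hp3 : 3 ≤ p) (hadd : Addv W p) :
    W.torsionOrder ∣ (W.baseChange ℚ_[p]).localTamagawaNumber ℤ_[p] * p := by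
  haveI : (W.baseChange ℚ_[p]).IsElliptic := by rw [baseChange]; infer_instance
  haveI := X11b.Three.JetchevKummer.hasAdditiveReduction_baseChange_padic_of_not_good_of_not_mult
    W p hadd.1 hadd.2
  exact (torsionOrder_dvd_natCard_torsion_padic' W p).trans
    (LocalLog.card_torsion_dvd_of_hasAdditiveReduction (W.baseChange ℚ_[p]) hp3)

/-- **`#E(ℚ)_tors ≤ 4p` at an additive prime `p ≥ 3`** (`∣ c_p · p`, `c_p ≤ 4`).
[cite: SilvermanAEC2009, VII.3 Prop. 3.1 and Thm. VII.6.1] -/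
theorem torsionOrder_le_four_mul_of_addv (hp3 : 3 ≤ p) (hadd : Addv W p) :
    W.torsionOrder ≤ 4 * p := by
  obtain ⟨hc0, hc4⟩ := localTamagawaNumber_padic_pos_le_four_of_addv W p hadd
  have h := Nat.le_of_dvd (Nat.mul_pos hc0 hp.out.pos)
    (torsionOrder_dvd_localTamagawaNumber_mul_of_addv W p hp3 hadd)
  nlinarith

end GlobalToLocal

/-! ## §2 `p = 3`: `ord₃ #E(ℚ)_tors ≤ 2` at an additive `3` (no Mazur), and `9 ∣ #E(ℚ)_tors` forces `c₃ = 3` -/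

section Three

variable (W : WeierstrassCurve ℚ) [W.IsElliptic] [W.IsGloballyMinimal] [h3 : Fact (Nat.Prime 3)]

/-- `#E(ℚ)_tors ∣ 3 · c₃` at an additive `3`. [cite: SilvermanAEC2009, VII.3 Prop. 3.1 and Thm. VII.6.1] -/
theorem torsionOrder_dvd_three_mul_localTamagawaNumber_of_addv_three (hadd : Addv W 3) :
    W.torsionOrder ∣ 3 * (W.baseChange ℚ_[3]).localTamagawaNumber ℤ_[3] := by
  rw [mul_comm]
  exact torsionOrder_dvd_localTamagawaNumber_mul_of_addv W 3 le_rfl hadd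

/-- **`#E(ℚ)_tors ≤ 12` at an additive `3`** (`∣ 3·c₃`, `c₃ ≤ 4`). [cite: SilvermanAEC2009, VII.3 Prop. 3.1 and Thm. VII.6.1] -/
theorem torsionOrder_le_twelve_of_addv_three (hadd : Addv W 3) : W.torsionOrder ≤ 12 := by
  have h := torsionOrder_le_four_mul_of_addv W 3 le_rfl hadd
  omega

/-- **No `ℤ/27` at an additive `3`: `27 ∤ #E(ℚ)_tors`** (`27 ∣ 3·c₃` would force `9 ∣ c₃ ≤ 4`) — WITHOUT Mazur's
torsion theorem. [cite: SilvermanAEC2009, VII.3 Prop. 3.1 and Thm. VII.6.1] -/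
theorem not_pow_three_dvd_torsionOrder_of_addv_three (hadd : Addv W 3) :
    ¬ 3 ^ 3 ∣ W.torsionOrder := by
  intro h27
  obtain ⟨hc0, hc4⟩ := localTamagawaNumber_padic_pos_le_four_of_addv W 3 hadd
  have h := h27.trans (torsionOrder_dvd_three_mul_localTamagawaNumber_of_addv_three W hadd)
  have h9 : 9 ∣ (W.baseChange ℚ_[3]).localTamagawaNumber ℤ_[3] := by
    have h' : 3 * 9 ∣ 3 * (W.baseChange ℚ_[3]).localTamagawaNumber ℤ_[3] := by
      simpa [pow_succ] using h
    exact Nat.dvd_of_mul_dvd_mul_left (by norm_num) h'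
  have := Nat.le_of_dvd hc0 h9
  omega

/-- **`ord₃ #E(ℚ)_tors ≤ 2` at an additive `3`, unconditionally** (so on the O6 rows the crux's torsion disjunct
«some member has `3² ∣ #tors`» cannot be escalated: `t_max ≤ 2`). [cite: SilvermanAEC2009, VII.3 Prop. 3.1 and Thm. VII.6.1] -/
theorem padicValNat_three_torsionOrder_le_two_of_addv_three (hadd : Addv W 3) :
    padicValNat 3 W.torsionOrder ≤ 2 := by
  have hpos : W.torsionOrder ≠ 0 := (W.torsionOrder_pos_holds).ne'
  by_contra hlt
  exact not_pow_three_dvd_torsionOrder_of_addv_three W hadd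
    ((padicValNat_dvd_iff_le hpos).mpr (by omega))

/-- **`9 ∣ #E(ℚ)_tors` at an additive `3` forces `c₃ = 3`** (`9 ∣ 3·c₃`, so `3 ∣ c₃ ∈ {1,…,4}`): the `ℤ/9` member of a
class in the stub's scope has Tamagawa number exactly `3` at `3` (census: 54b3, 1890r3, 122094bl3).
[cite: SilvermanAEC2009, VII.3 Prop. 3.1 and Thm. VII.6.1] [cite: BarriosRoy2022LocalData, Thm. 3.8 (table, T = C₉: c₃ = 3)] -/
theorem localTamagawaNumber_eq_three_of_nine_dvd_torsionOrder_of_addv_three (hadd : Addv W 3)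
    (h9 : 3 ^ 2 ∣ W.torsionOrder) : (W.baseChange ℚ_[3]).localTamagawaNumber ℤ_[3] = 3 := by
  obtain ⟨hc0, hc4⟩ := localTamagawaNumber_padic_pos_le_four_of_addv W 3 hadd
  have h := h9.trans (torsionOrder_dvd_three_mul_localTamagawaNumber_of_addv_three W hadd)
  have h3c : 3 ∣ (W.baseChange ℚ_[3]).localTamagawaNumber ℤ_[3] := by
    have h' : 3 * 3 ∣ 3 * (W.baseChange ℚ_[3]).localTamagawaNumber ℤ_[3] := by
      simpa [pow_two] using h
    exact Nat.dvd_of_mul_dvd_mul_left (by norm_num) h'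
  interval_cases ((W.baseChange ℚ_[3]).localTamagawaNumber ℤ_[3]) <;> omega

/-- `9 ∣ #E(ℚ)_tors` at an additive `3` gives `ord₃ #E(ℚ)_tors = 2` exactly. [cite: SilvermanAEC2009, VII.3 Prop. 3.1 and Thm. VII.6.1] -/
theorem padicValNat_three_torsionOrder_eq_two_of_nine_dvd_of_addv_three (hadd : Addv W 3)
    (h9 : 3 ^ 2 ∣ W.torsionOrder) : padicValNat 3 W.torsionOrder = 2 := by
  have hpos : W.torsionOrder ≠ 0 := (W.torsionOrder_pos_holds).ne'
  have hge : 2 ≤ padicValNat 3 W.torsionOrder := (padicValNat_dvd_iff_le hpos).mp h9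
  have hle := padicValNat_three_torsionOrder_le_two_of_addv_three W hadd
  omega

end Three

/-! ## §3 Prime-to-`ℓ` torsion at an additive prime `ℓ`: a rational point of order `q^k`, `q ≠ ℓ`, forces `q^k ∣ c_ℓ` -/

section AwayFromQ

variable (W : WeierstrassCurve ℚ) [W.IsElliptic] [W.IsGloballyMinimal] (ℓ : ℕ) [hℓ : Fact ℓ.Prime]

/-- **A rational point of order `q^k` (`q ≠ ℓ` prime) at an ADDITIVE prime `ℓ` forces `q^k ∣ c_ℓ`** — for every prime
`ℓ`, `2` included. Its image `Q ∈ E(ℚ_ℓ)` has order `q^k`; `E₁(ℚ_ℓ)` has no `q`-torsion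
(`X11b.LocalTorsion.eq_zero_of_isInReductionKernel_of_prime_nsmul`, *AEC* IV.3.2(b)), so the class of `Q` in
`E(ℚ_ℓ)/E₁(ℚ_ℓ)` still has order `q^k`, which therefore divides `[E(ℚ_ℓ) : E₁(ℚ_ℓ)] = c_ℓ · ℓ`
(`index_formalFiltration_one_of_additive`), and `gcd(q^k, ℓ) = 1`.
[cite: SilvermanAEC2009, VII.2 Prop. 2.1, VII.3 Prop. 3.1, IV.3.2(b) and Exercise 3.5] -/
theorem pow_dvd_localTamagawaNumber_of_addOrderOf_eq_of_addv {q k : ℕ} (hq : q.Prime) (hqℓ : q ≠ ℓ)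
    (hadd : Addv W ℓ) {P : W.toAffine.Point} (hP : addOrderOf P = q ^ k) :
    q ^ k ∣ (W.baseChange ℚ_[ℓ]).localTamagawaNumber ℤ_[ℓ] := by
  haveI : (W.baseChange ℚ_[ℓ]).IsElliptic := by rw [baseChange]; infer_instance
  -- the image `Q` of `P` in `E(ℚ_ℓ)` has the same order
  set ι : W.toAffine.Point →+ (W.baseChange ℚ_[ℓ]).toAffine.Point :=
    WeierstrassCurve.Affine.Point.map (W' := W.toAffine) (S := ℚ) (Algebra.ofId ℚ ℚ_[ℓ]) with hι
  have hinj : Function.Injective ι :=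
    WeierstrassCurve.Affine.Point.map_injective (W' := W.toAffine) (f := Algebra.ofId ℚ ℚ_[ℓ])
  set Q := ι P with hQ
  have hQord : addOrderOf Q = q ^ k := (addOrderOf_injective ι hinj P).trans hP
  -- the quotient `G = E(ℚ_ℓ)/E₁(ℚ_ℓ)` has order `c_ℓ · ℓ`
  set F1 := (W.baseChange ℚ_[ℓ]).formalFiltration 1 with hF1
  set c := (W.baseChange ℚ_[ℓ]).localTamagawaNumber ℤ_[ℓ] with hc
  have hidx : F1.index = c * ℓ := index_formalFiltration_one_of_additive W ℓ hadd.1 hadd.2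
  set π : (W.baseChange ℚ_[ℓ]).toAffine.Point →+ _ ⧸ F1 := QuotientAddGroup.mk' F1 with hπ
  -- the order of `π Q` is exactly `q ^ k`
  have hkill : q ^ k • π Q = 0 := by rw [← map_nsmul, ← hQord, addOrderOf_nsmul_eq_zero, map_zero]
  obtain ⟨j, hjk, hj⟩ := (Nat.dvd_prime_pow hq).mp (addOrderOf_dvd_of_nsmul_eq_zero hkill)
  have hjeq : j = k := by
    by_contra hne
    have hjlt : j < k := lt_of_le_of_ne hjk hne
    -- then `q^(k-1) • Q ∈ E₁(ℚ_ℓ)` is killed by the prime `q ≠ ℓ`, hence is `O`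
    have hk1 : q ^ j ∣ q ^ (k - 1) := pow_dvd_pow q (by omega)
    have hzero : q ^ (k - 1) • π Q = 0 := by
      obtain ⟨m, hm⟩ := hk1
      rw [hm, mul_nsmul, ← hj, addOrderOf_nsmul_eq_zero, nsmul_zero]
    have hmem : q ^ (k - 1) • Q ∈ F1 := by
      rw [← QuotientAddGroup.eq_zero_iff, ← hzero, hπ, QuotientAddGroup.mk'_apply,
        QuotientAddGroup.mk_nsmul]
    have hker : (W.baseChange ℚ_[ℓ]).IsInReductionKernel (q ^ (k - 1) • Q) := hmem.1
    have hqkill : q • (q ^ (k - 1) • Q) = 0 := by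
      rw [smul_smul, ← pow_succ', Nat.sub_add_cancel (by omega), ← hQord, addOrderOf_nsmul_eq_zero]
    have h0 : q ^ (k - 1) • Q = 0 :=
      X11b.LocalTorsion.eq_zero_of_isInReductionKernel_of_prime_nsmul (W.baseChange ℚ_[ℓ]) hq
        (fun h ↦ hqℓ h.symm) hker hqkill
    have hdvd : q ^ k ∣ q ^ (k - 1) := by
      rw [← hQord]; exact addOrderOf_dvd_of_nsmul_eq_zero h0
    have := Nat.le_of_dvd (pow_pos hq.pos _) hdvd
    have hlt : q ^ (k - 1) < q ^ k := Nat.pow_lt_pow_right hq.one_lt (by omega)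
    omega
  subst hjeq
  -- so `q ^ j ∣ #G = c · ℓ`, and `q ≠ ℓ` gives `q ^ j ∣ c`
  have hG : q ^ j ∣ c * ℓ := by
    rw [← hidx, AddSubgroup.index_eq_card, ← hj]
    exact addOrderOf_dvd_natCard (π Q)
  have hcop : (q ^ j).Coprime ℓ := ((Nat.coprime_primes hq hℓ.out).mpr hqℓ).pow_left j
  exact hcop.dvd_of_dvd_mul_right hG

/-- **Prime-power rational torsion coprime to an additive prime `ℓ` has order `≤ 4`** (`q^k ∣ c_ℓ ≤ 4`).
[cite: SilvermanAEC2009, VII.3 Prop. 3.1 and Thm. VII.6.1] [cite: SilvermanATAEC1994, Cor. IV.9.2(d)] -/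
theorem pow_le_four_of_addOrderOf_eq_of_addv {q k : ℕ} (hq : q.Prime) (hqℓ : q ≠ ℓ)
    (hadd : Addv W ℓ) {P : W.toAffine.Point} (hP : addOrderOf P = q ^ k) : q ^ k ≤ 4 := by
  obtain ⟨hc0, hc4⟩ := localTamagawaNumber_padic_pos_le_four_of_addv W ℓ hadd
  exact (Nat.le_of_dvd hc0
    (pow_dvd_localTamagawaNumber_of_addOrderOf_eq_of_addv W ℓ hq hqℓ hadd hP)).trans hc4

/-- **A curve with a rational point of order `9` is NOT additive at any prime `ℓ ≠ 3`** (`9 ∣ c_ℓ ≤ 4` is absurd):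
it is semistable away from `3`. In print for the Kubert family `E_{C₉}`: additive reduction occurs iff `p = 3`.
[cite: SilvermanAEC2009, VII.3 Prop. 3.1 and Thm. VII.6.1] [cite: BarriosRoy2022LocalData, Thm. 3.8 (table, T = C₉)] -/
theorem not_addv_of_addOrderOf_eq_nine {ℓ : ℕ} [Fact ℓ.Prime] (hℓ3 : ℓ ≠ 3)
    {P : W.toAffine.Point} (hP : addOrderOf P = 9) : ¬ Addv W ℓ := fun hadd ↦ by
  have h := pow_le_four_of_addOrderOf_eq_of_addv W ℓ (q := 3) (k := 2) Nat.prime_three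
    (fun h ↦ hℓ3 h.symm) hadd (by rw [hP]; norm_num)
  norm_num at h

end AwayFromQ

/-! ## §4 A rational point of order `9` from `9 ∣ #E(ℚ)_tors` (no Mazur) -/

section PointOfOrderNine

variable (W : WeierstrassCurve ℚ) [W.IsElliptic]

/-- **An ODD divisor `n` of `#E(ℚ)_tors` is the order of a rational point**: `E(ℚ)_tors ≅ ℤ/k` or `ℤ/2k × ℤ/2` (Weil
pairing; tree `exists_torsionOrder_eq_addOrderOf_or`), so `n ∣ k` resp. `n ∣ 2k`, i.e. `n` divides the order of a
rational point `P₀`, and `(ord P₀ / n) • P₀` has order `n`. [cite: CremonaAlgorithms1997, §3.3 p. 52] -/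
theorem exists_addOrderOf_eq_of_odd_of_dvd_torsionOrder {n : ℕ} (hn : Odd n) (hdvd : n ∣ W.torsionOrder) :
    ∃ P : W.toAffine.Point, addOrderOf P = n := by
  obtain ⟨P₀, hfin, hP₀⟩ := exists_torsionOrder_eq_addOrderOf_or W
  have hn0 : n ≠ 0 := by rintro rfl; exact (Nat.not_odd_zero hn).elim
  have hdvd' : n ∣ addOrderOf P₀ := by
    rcases hP₀ with h | h
    · rwa [h] at hdvd
    · rw [h] at hdvd
      exact (Nat.Coprime.dvd_of_dvd_mul_left (Nat.Coprime.symm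
        ((Nat.coprime_two_left).mpr hn)) hdvd)
  set m := addOrderOf P₀ / n with hm
  have hm0 : m ≠ 0 := by
    rw [hm]
    exact (Nat.div_pos (Nat.le_of_dvd hfin.addOrderOf_pos hdvd') (Nat.pos_of_ne_zero hn0)).ne'
  have hmdvd : m ∣ addOrderOf P₀ := Nat.div_dvd_of_dvd hdvd'
  refine ⟨m • P₀, ?_⟩
  rw [addOrderOf_nsmul_of_dvd hm0 hmdvd, hm, Nat.div_div_self hdvd' hfin.addOrderOf_pos.ne']

/-- **`9 ∣ #E(ℚ)_tors ⟹ E(ℚ)` has a point of order `9`** (no Mazur): the stub's hypothesis `3² ∣ #W'(ℚ)_tors` says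
exactly that `W'` is a fibre of `X₁(9)`. [cite: CremonaAlgorithms1997, §3.3 p. 52] -/
theorem exists_addOrderOf_eq_nine_of_dvd_torsionOrder (h9 : 3 ^ 2 ∣ W.torsionOrder) :
    ∃ P : W.toAffine.Point, addOrderOf P = 9 :=
  exists_addOrderOf_eq_of_odd_of_dvd_torsionOrder W (by decide) (by simpa using h9)

/-- `9 ∣ #E(ℚ)_tors` (`W/ℚ` globally minimal) ⟹ not additive at any `ℓ ≠ 3`. [cite: SilvermanAEC2009, VII.3 Prop. 3.1 and Thm. VII.6.1] -/
theorem not_addv_of_nine_dvd_torsionOrder [W.IsGloballyMinimal] (h9 : 3 ^ 2 ∣ W.torsionOrder) {ℓ : ℕ}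
    [Fact ℓ.Prime] (hℓ3 : ℓ ≠ 3) : ¬ Addv W ℓ := by
  obtain ⟨P, hP⟩ := exists_addOrderOf_eq_nine_of_dvd_torsionOrder W h9
  exact not_addv_of_addOrderOf_eq_nine W hℓ3 hP

end PointOfOrderNine

/-! ## §5 The Kodaira type at `3` of a curve with `9 ∣ #E(ℚ)_tors`: `IV` or `IV*` — the WILD cell O6, never (t′) -/

section Kodaira

variable (W : WeierstrassCurve ℚ) [W.IsElliptic] [W.IsGloballyMinimal] [Fact (Nat.Prime 3)]

/-- **Additive at `3` with `9 ∣ #E(ℚ)_tors ⟹ Kodaira type `IV` or `IV*` at `3`.** `c₃ = 3` (§2) divides the geometric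
component-group order `#Φ₃(𝔽̄₃)` of the Kodaira symbol (`localTamagawaNumber_dvd_componentGroupOrder` with
`nonempty_neronComponentData_holds`), which among the additive types at `3` (`kodairaSymbolAt_three_cases_of_addv`:
`Iₙ*`, `III`, `III*`, `II`, `IV`, `IV*`, `II*`, orders `4, 2, 2, 1, 3, 3, 1`) happens only for `IV`, `IV*`.
In print for `E_{C₉}`: type `IV` (Barrios–Roy). [cite: SilvermanATAEC1994, Cor. IV.9.2(c),(d) and Table 4.1 (PDF p. 365)]
[cite: BarriosRoy2022LocalData, Thm. 3.8 (table, T = C₉: type IV, f₃ = 3, c₃ = 3)] -/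
theorem kodairaSymbolAt_three_eq_IV_or_IVstar_of_nine_dvd_torsionOrder (hadd : Addv W 3)
    (h9 : 3 ^ 2 ∣ W.torsionOrder) :
    W.kodairaSymbolAt (placeOf 3) = .IV ∨ W.kodairaSymbolAt (placeOf 3) = .IVstar := by
  have hc3 := localTamagawaNumber_eq_three_of_nine_dvd_torsionOrder_of_addv_three W hadd h9
  rw [localTamagawaNumber_padic_eq_placeOf W 3] at hc3
  have hdvd : 3 ∣ (W.kodairaSymbolAt (placeOf 3)).componentGroupOrder := by
    have h := localTamagawaNumber_dvd_componentGroupOrder (placeOf 3) W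
      (nonempty_neronComponentData_holds W (placeOf 3))
    rwa [hc3] at h
  rcases kodairaSymbolAt_three_cases_of_addv W hadd with ⟨n, hn⟩ | h0 | (h | h) | (h | h | h | h)
  · rw [hn] at hdvd; simp only [KodairaSymbol.componentGroupOrder] at hdvd; omega
  · rw [h0] at hdvd; simp only [KodairaSymbol.componentGroupOrder] at hdvd; omega
  · rw [h] at hdvd; simp only [KodairaSymbol.componentGroupOrder] at hdvd; omega
  · rw [h] at hdvd; simp only [KodairaSymbol.componentGroupOrder] at hdvd; omega
  · rw [h] at hdvd; simp only [KodairaSymbol.componentGroupOrder] at hdvd; omega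
  · exact Or.inl h
  · exact Or.inr h
  · rw [h] at hdvd; simp only [KodairaSymbol.componentGroupOrder] at hdvd; omega

/-- **Additive at `3` with `9 ∣ #E(ℚ)_tors ⟹ the wild cell `SubW W 3`** (`IV`/`IV*` are wild at `3`:
`subW_three_iff_kodairaSymbolAt_wild`). [cite: SilvermanATAEC1994, IV.10.4 and Table 4.1 (PDF p. 365)] -/
theorem subW_three_of_nine_dvd_torsionOrder (hadd : Addv W 3) (h9 : 3 ^ 2 ∣ W.torsionOrder) :
    SubW W 3 :=
  (subW_three_iff_kodairaSymbolAt_wild W hadd).mpr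
    ((kodairaSymbolAt_three_eq_IV_or_IVstar_of_nine_dvd_torsionOrder W hadd h9).elim
      (fun h ↦ Or.inr (Or.inl h)) fun h ↦ Or.inr (Or.inr (Or.inl h)))

/-- **A `ℤ/9` curve additive at `3` is an O6 row**: `Addv W 3 → 3² ∣ #W(ℚ)_tors → ClassO6 W 3`. So the `ℤ/9` member
of a class in the stub's scope is itself in the crux's cell (wild, potentially good, `E[3]` reducible by its rational
`3`-torsion). [cite: SilvermanATAEC1994, IV.10.4 and Table 4.1 (PDF p. 365)] -/
theorem classO6_three_of_nine_dvd_torsionOrder (hadd : Addv W 3) (h9 : 3 ^ 2 ∣ W.torsionOrder) :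
    ClassO6 W 3 :=
  ⟨by decide, hadd, subW_three_of_nine_dvd_torsionOrder W hadd h9⟩

/-- **… and never a (t′) row** (`III`/`III*` at `3` have `c₃ = 2`): the K8-t′ twin stub `stub_red_pSqTorsionMember` at
`p = 3` has no row whose `ℤ/9` member is itself (t′) (cf. the K8-t′ lane's `TorsionVoid` files, which prove the class
form granted Ogg–Saito). [cite: SilvermanATAEC1994, IV.9.4 Steps 4, 9 and Table 4.1 (PDF pp. 344–346, 365)] -/
theorem not_subTprime_three_of_nine_dvd_torsionOrder (hadd : Addv W 3) (h9 : 3 ^ 2 ∣ W.torsionOrder) :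
    ¬ SubTprime W 3 := by
  intro hT
  have hK := (subTprime_three_iff_kodairaSymbolAt_III_or_IIIstar W hadd).mp hT
  rcases kodairaSymbolAt_three_eq_IV_or_IVstar_of_nine_dvd_torsionOrder W hadd h9 with h | h <;>
    rcases hK with h' | h' <;> rw [h] at h' <;> simp at h'

end Kodaira

end Summit.BirchSwinnertonDyer.BirchSwinnertonDyer.Theorems.WildUpperReducibleNineTorsionLocal

end
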